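import Summits.BirchSwinnertonDyer.BirchSwinnertonDyer.Theorems.RamifiedHeegnerPairTwistUnitInertZero
import HarnessLib

/-!
# U₀ at the two-SPLIT-carrier Gss2 classes (rank zero; the Shimura rows), TU₀|inert — part R: `472410bu1`, `113274bp1`

Continuation of `…Theorems.RamifiedHeegnerPairTwistUnitInertZero` (seat `bsd-trib-w-rhp` g14; the two rank-zero doors
`leafRankZeroUpper_three_of_twoCarriers_of_sqrtField` / `leafRankZeroUpper_three_of_twoInert_twoOutside_of_sqrtField` and the full framing are there; the generic
kernel lemmas are in `…TwistUnitInert`): per rank-zero curve `subGss_three_<label>` (Addv ∧ SubGss at `3` in the kernel), `Δ_eq_/c₄_eq_/krausList_<label>`, Kraus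
minimality of `V = E^{(-3)}_min` and of the twist model `Wd`, and `u0_at_<label> : … → MissingUpperBoundAt W 3` by rhp-p2 g10's certificate shape p662479
`LeafShimuraInert.leafRankZeroUpper_three_of_shimuraInertDatum_of_twistUnitZero` with the six printed facts `hGZK hmod hnf hJL hCO hHK` as hypotheses, the split / no-split / Tate
certificates, `hothers`, `hshape` and the field congruences IN THE KERNEL, and `hN hr Dt hc` + `L(E^D,1) = 0 ≠ L′(E^D,1)` + `#Ш(Wd)_an` DISPLAYED (census kit j318499:
rank-one-twist certificates `X = L′·T²/(Ω·∏c·ĥ)` at a saturated point).  **HONEST FRAMING: theorems only; nothing is booked, no item is closed; U₀ (26024) /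
TU₀|inert / the Shimura-curve Gross–Zagier–Kolyvagin inputs stay research-level and OPEN class-wide; BSD is NOT proved for any curve by this file.**
[cite: JetchevSkinnerWan2017, §7.4.2 (p. 31), Thm. 4.4.1 (p. 19)] [cite: PastenShimura2024, Prop. 6.13, Lemma 6.16, Lemma 6.18 (pp. 23–24)]
[cite: PapikianRabinoff2016, Cor. 3.5] [cite: SilvermanAEC2009, VII.5 Prop. 5.1] [cite: SilvermanATAEC1994, IV.9.4] [cite: Tate1975, §7] [cite: Kraus1989, Prop. 1]
[cite: Marcus2018, Ch. 3 Thm. 25] [cite: Miller2011LMS, Def. 1.1] [cite: Cremona2006, Table 1]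
-/

set_option linter.dupNamespace false
set_option autoImplicit false

noncomputable section

open scoped Classical NumberField

open WeierstrassCurve NumberField IsDedekindDomain IsDedekindDomain.HeightOneSpectrum Rat.HeightOneSpectrum Field Literature Literature.NumberTheory.DiophantineGeometry
  Literature.NumberTheory.EllipticCurves Literature.NumberTheory.EllipticCurves.ModularForms Literature.NumberTheory.EllipticCurves.Rank1Residual
  Literature.NumberTheory.EllipticCurves.Rank1Residual.Typed Literature.NumberTheory.Automorphic Literature.NumberTheory.EllipticCurves.Rank1Residual.X11RankOneCertificates
  Literature.NumberTheory.EllipticCurves.KrizLi2019 Literature.NumberTheory.GaloisRepresentations Literature.NumberTheory.QuadraticFields Literature.NumberTheory.QuadraticFields.Quadratic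
  Summit.BirchSwinnertonDyer.BirchSwinnertonDyer.Rank1Residual Summit.BirchSwinnertonDyer.BirchSwinnertonDyer.Rank1Residual.IntModel
  Summit.BirchSwinnertonDyer.BirchSwinnertonDyer.Rank2Observatory.Tam Summit.BirchSwinnertonDyer.Rank1Residual Summit.BirchSwinnertonDyer.Rank1Residual.Additive
  Summit.BirchSwinnertonDyer.Rank1Residual.X11b Summit.BirchSwinnertonDyer.Rank1Residual.X11b.Three Summit.BirchSwinnertonDyer.Rank1Residual.X9 Summit.BirchSwinnertonDyer.Rank1Residual.GaloisImage
  Summit.BirchSwinnertonDyer.Rank1Residual.Supersingular Summit.BirchSwinnertonDyer.BirchSwinnertonDyer.Theses.RamifiedHeegnerPair Summit.BirchSwinnertonDyer.BirchSwinnertonDyer.Theorems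
  Summit.BirchSwinnertonDyer.BirchSwinnertonDyer.Theorems.SchneiderFree Summit.BirchSwinnertonDyer.BirchSwinnertonDyer.Theorems.RamifiedPairUpperBound
  Summit.BirchSwinnertonDyer.BirchSwinnertonDyer.Theorems.RamifiedHeegnerPairStepLIntrinsic Summit.BirchSwinnertonDyer.BirchSwinnertonDyer.Theorems.AdditiveBranchIMCGordTwoRankOne.HeegnerKolyvagin
  Summit.BirchSwinnertonDyer.BirchSwinnertonDyer.Theorems.RamifiedHeegnerPairTwistUnitIntrinsic Summit.BirchSwinnertonDyer.BirchSwinnertonDyer.Theorems.RamifiedHeegnerPairTwistUnitAdditive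

namespace Summit.BirchSwinnertonDyer.BirchSwinnertonDyer.Theorems.RamifiedHeegnerPairTwistUnitInertZero

open RamifiedHeegnerPairTwistUnitInert

/-! ## §33 `472410bu1` = `[1, -1, 1, -137552897, -620682608879]`, `N = 472410 = 2·3^2·5·29·181` (`2`: I28, `c = 28`, split, `3`: I₀*, `c = 2`, `5`: I3, `c = 3`, split, `29`: I2, `c = 2`, split, `181`: I3, `c = 3`, split); carriers `S = {181, 5}` (split, `3 ∣ ord Δ`), (DEG) by Papikian–Rabinoff at `q₂ = 5` (odd, `≡ 2 (mod 3)`);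
`r_an = 0`, `#E(ℚ)_tors = 2`, `∏ c_ℓ = 1008`, `#Ш(E)_an = 1` (Cremona/LMFDB, displayed where used); class `472410bu` of size 2.
`V = E^{(-3)}_min = [1, -1, 0, -15283655, 22993339325]` (`#Ṽ(𝔽₃) = 4`).  JSW field `K = ℚ(√-23)` (`23` prime; `181`, `5` inert, every other `ℓ ∣ N` split): the least such `D` (among those tried) with a CERTIFIED twist unit
(kit j318499: root no. `−1`, `L′(Wd,1) = 14.374877`, `Wd = E^{(-23)}_min = [1, -1, 1, -72765482348, 7552281895121647]`, `N(Wd) = 249904890`, `∏c = 448`, `T = 2`, point by `ellrank(effort=0)`, eclib-full saturation (index 1), `ĥ = 5.978586`,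
`X = L′T²/(Ω∏c ĥ) = 1` to `2e-16` — the numerical `#Ш(Wd)_an` given rank `1`). -/

/-- `V = [1, -1, 0, -15283655, 22993339325]` (the minimal model of `472410bu1^{(-3)}`, conductor `52490`): `Δ ≠ 0` in the kernel. [cite: Cremona2006, Table 1 (Cremona label 472410bu1)] -/
theorem isElliptic_sV472410bu1 : (⟨1, -1, 0, -15283655, 22993339325⟩ : WeierstrassCurve ℚ).IsElliptic :=
  isElliptic_of_discOf_ne_zero 1 (-1) 0 (-15283655) 22993339325 (by decide +kernel)

/-- `V` is globally minimal: `|Δ| = 2^28·5^3·29^2·181^3` kernel-checked, Kraus' criterion prime by prime. [cite: Kraus1989, Prop. 1 and Prop. 2]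
[cite: SilvermanAEC2009, VII.1 Remark 1.1] [cite: Cremona2006, Table 1 (Cremona label 472410bu1)] -/
theorem isGloballyMinimal_sV472410bu1 : (⟨1, -1, 0, -15283655, 22993339325⟩ : WeierstrassCurve ℚ).IsGloballyMinimal :=
  isGloballyMinimal_of_krausCriterion₃_factored 1 (-1) 0 (-15283655) 22993339325
    [(2, 28), (5, 3), (29, 2), (181, 3)] (by decide +kernel)
    (by intro qe hqe; simp only [List.mem_cons, List.not_mem_nil, or_false] at hqe
        rcases hqe with rfl | rfl | rfl | rfl <;> norm_num)
    (by set_option synthInstance.maxSize 2000 in decide +kernel)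

/-- `Wd = [1, -1, 1, -72765482348, 7552281895121647]` (the minimal model of the twist `472410bu1^{(-23)}`, conductor `249904890`): `Δ ≠ 0` in the kernel. [cite: Cremona2006, Table 1 (Cremona label 472410bu1)] -/
theorem isElliptic_sWd472410bu1 : (⟨1, -1, 1, -72765482348, 7552281895121647⟩ : WeierstrassCurve ℚ).IsElliptic :=
  isElliptic_of_discOf_ne_zero 1 (-1) 1 (-72765482348) 7552281895121647 (by decide +kernel)

/-- `Wd` is globally minimal: `|Δ| = 2^28·3^6·5^3·23^6·29^2·181^3` kernel-checked, Kraus' criterion prime by prime. [cite: Kraus1989, Prop. 1 and Prop. 2]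
[cite: SilvermanAEC2009, VII.1 Remark 1.1] [cite: Cremona2006, Table 1 (Cremona label 472410bu1)] -/
theorem isGloballyMinimal_sWd472410bu1 : (⟨1, -1, 1, -72765482348, 7552281895121647⟩ : WeierstrassCurve ℚ).IsGloballyMinimal :=
  isGloballyMinimal_of_krausCriterion₃_factored 1 (-1) 1 (-72765482348) 7552281895121647
    [(2, 28), (3, 6), (5, 3), (23, 6), (29, 2), (181, 3)] (by decide +kernel)
    (by intro qe hqe; simp only [List.mem_cons, List.not_mem_nil, or_false] at hqe
        rcases hqe with rfl | rfl | rfl | rfl | rfl | rfl <;> norm_num)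
    (by set_option synthInstance.maxSize 2000 in decide +kernel)

/-- **`472410bu1` is ADDITIVE at `3` and on the cell (G) ∧ ss, IN THE KERNEL**: `3 ∣ Δ`, `3 ∣ c₄`; `C • V^{(-3)} = E` (`[u, r, s, t] = [1, -1, 1/2, 1/2]`) with
`V` globally minimal, `3 ∤ Δ(V)`, `#Ṽ(𝔽₃) = 4` (`a₃(V) = 0`, supersingular), whence `TypeG`, `SubGord`, `SubGss` at `3` (g13's block, unchanged).
[cite: SilvermanAEC2009, VII.5 Prop. 5.1 (a), (c)] [cite: Delbourgo1998, §1.5 (G)] [cite: Cremona2006, Table 1 (Cremona label 472410bu1)] -/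
theorem subGss_three_472410bu1 {W : WeierstrassCurve ℚ} [W.IsElliptic] [W.IsGloballyMinimal] (hWeq : W = (⟨1, -1, 1, -137552897, -620682608879⟩ : WeierstrassCurve ℚ)) :
    Addv W 3 ∧ SubGss W 3 := by
  subst hWeq
  haveI := isElliptic_sV472410bu1
  haveI := isGloballyMinimal_sV472410bu1
  have hIW : integralModelInt (⟨1, -1, 1, -137552897, -620682608879⟩ : WeierstrassCurve ℚ) = (⟨1, -1, 1, -137552897, -620682608879⟩ : WeierstrassCurve ℤ) :=
    integralModelInt_eq_of_map_eq _ (map_mk_int 1 (-1) 1 (-137552897) (-620682608879))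
  have hadd : Addv (⟨1, -1, 1, -137552897, -620682608879⟩ : WeierstrassCurve ℚ) 3 := Additive.addv_of_intModel hIW 3 (by decide +kernel) (by decide +kernel)
  have hIV : integralModelInt (⟨1, -1, 0, -15283655, 22993339325⟩ : WeierstrassCurve ℚ) = (⟨1, -1, 0, -15283655, 22993339325⟩ : WeierstrassCurve ℤ) :=
    integralModelInt_eq_of_map_eq _ (map_mk_int 1 (-1) 0 (-15283655) 22993339325)
  have hcV : Nat.card ((((⟨1, -1, 0, -15283655, 22993339325⟩ : WeierstrassCurve ℤ)).map (Int.castRingHom (ZMod 3))).toAffine.Point) = 4 := by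
    have h := natCard_point_eq_countPoints 1 (-1) 0 (-15283655) 22993339325 3 (by norm_num) (by decide +kernel)
    have h' : countPoints [1, -1, 0, -15283655, 22993339325] 3 = 4 := countPoints_eq_of_fast (by decide +kernel)
    exact_mod_cast h.trans h'
  have hgood : GoodSS (⟨1, -1, 0, -15283655, 22993339325⟩ : WeierstrassCurve ℚ) 3 := Supersingular.goodSS_of_intModel 3 hIV (by decide +kernel) hcV (by decide)
  have hVW : (⟨1, (-1 : ℚ), ((1:ℚ)/2), ((1:ℚ)/2)⟩ : VariableChange ℚ) • (⟨1, -1, 0, -15283655, 22993339325⟩ : WeierstrassCurve ℚ).quadraticTwist (-3) =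
      (⟨1, -1, 1, -137552897, -620682608879⟩ : WeierstrassCurve ℚ) := by
    ext <;> simp [WeierstrassCurve.variableChange_a₁, WeierstrassCurve.variableChange_a₂,
      WeierstrassCurve.variableChange_a₃, WeierstrassCurve.variableChange_a₄, WeierstrassCurve.variableChange_a₆,
      WeierstrassCurve.quadraticTwist, WeierstrassCurve.b₂, WeierstrassCurve.b₄, WeierstrassCurve.b₆] <;> norm_num
  obtain ⟨C, hC⟩ := exists_variableChange_quadraticTwist_symm (⟨1, -1, 1, -137552897, -620682608879⟩ : WeierstrassCurve ℚ)
    (⟨1, -1, 0, -15283655, 22993339325⟩ : WeierstrassCurve ℚ) (d := (-3 : ℚ)) (by norm_num) ⟨_, hVW⟩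
  have hC' : C • (⟨1, -1, 1, -137552897, -620682608879⟩ : WeierstrassCurve ℚ).quadraticTwist ((-1 : ℚ) ^ ((3 : ℕ) / 2) * (3 : ℕ)) =
      (⟨1, -1, 0, -15283655, 22993339325⟩ : WeierstrassCurve ℚ) := by
    rw [O5.pstar_three]; exact hC
  have hG : TypeG (⟨1, -1, 1, -137552897, -620682608879⟩ : WeierstrassCurve ℚ) 3 := (typeG_three_iff_good_twist _ hadd _ C hC').mpr hgood.1
  exact ⟨hadd, (O5.subGss_three_iff_subGord_and_goodSS_twist _ hadd _ C hC).mpr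
    ⟨subGord_three_of_typeG_of_addv _ hG hadd, hgood⟩⟩

/-- `Δ(E₀) = 121985761131488083968000 = 2^28·3^6·5^3·29^2·181^3` on the integer equation of `472410bu1`. [cite: Cremona2006, Table 1 (Cremona label 472410bu1)] -/
theorem Δ_eq_472410bu1 : (⟨1, -1, 1, -137552897, -620682608879⟩ : WeierstrassCurve ℤ).Δ = 121985761131488083968000 := by
  norm_num [WeierstrassCurve.Δ, WeierstrassCurve.b₂, WeierstrassCurve.b₄, WeierstrassCurve.b₆, WeierstrassCurve.b₈]

/-- `c₄(E₀) = 6602539041` on the integer equation of `472410bu1`. [cite: Cremona2006, Table 1 (Cremona label 472410bu1)] -/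
theorem c₄_eq_472410bu1 : (⟨1, -1, 1, -137552897, -620682608879⟩ : WeierstrassCurve ℤ).c₄ = 6602539041 := by
  norm_num [WeierstrassCurve.c₄, WeierstrassCurve.b₂, WeierstrassCurve.b₄]

/-- The Kraus list of `472410bu1` consists of primes and multiplies to `|Δ(E₀)|`, IN THE KERNEL: a prime dividing `Δ_min` is one of `[2, 3, 5, 29, 181]`. [cite: Cremona2006, Table 1 (Cremona label 472410bu1)] -/
theorem krausList_472410bu1 : (∀ qe ∈ ([(2, 28), (3, 6), (5, 3), (29, 2), (181, 3)] : List (ℕ × ℕ)), qe.1.Prime) ∧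
    (([(2, 28), (3, 6), (5, 3), (29, 2), (181, 3)] : List (ℕ × ℕ)).map fun qe => qe.1 ^ qe.2).prod = (121985761131488083968000 : ℤ).natAbs :=
  ⟨by decide +kernel, by decide +kernel⟩

/-- **U₀ AT `472410bu1` BY THE INERT-CARRIER (Shimura-curve) ROAD, TU₀|inert** — `MissingUpperBoundAt W 3` at `W = E` (`r_an = 0`) from rhp-p2 g10's certificate shape
p662479 `leafRankZeroUpper_three_of_shimuraInertDatum_of_twistUnitZero` (Papikian–Rabinoff (DEG) at the odd carrier) through the §0 door `leafRankOneUpper_three_of_twoCarriers_of_sqrtField` of part one.  PRINTED: `hGZK hmod hnf hJL hCO hHK`.  KERNEL: `Addv ∧ SubGss` at `3`;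
`181`, `5` split (nodal roots `4`, `1`); every prime of `Δ_min` enumerated (`krausList_472410bu1`) for `hothers` and `hshape` (`c = 1` off `Δ_min`, Kodaira–Néron at the
multiplicative primes, Tate certificates at the additive primes `[3]`); the congruences making `181`, `5` inert and the other `ℓ ∣ N` split in `ℚ(√-23)`; the twist
identity `Cd • E^{(-23)} = Wd`, `Cd = [1, -6, 1/2, 1/2]`, with `Wd` Kraus-minimal.  DISPLAYED: `hN`, `hr` (`r_an = 0`), `Dt`/`hc` (`3 ∤ c(Dt)`), `hLt0`/`hLt1` (`L(E^{(-23)},1) = 0 ≠ L′(E^{(-23)},1)`; census: root number `−1`, `L′(Wd,1) ≈ 14.374877`),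
`hqd`/`hvd` (`#Ш(Wd)_an = 1`; census: `X = L′·T²/(Ω·∏c·ĥ(P)) = 1` to `2.2e-16` at the eclib-full-saturated point `P` of height `5.978586` found by `ellrank(effort=0)`).
NO ¬CM / S2 / Σ / L₀ / L₁.  Per curve; U₀ (26024) stays OPEN class-wide; BSD is NOT proved by this.
[cite: JetchevSkinnerWan2017, §7.4.2 (p. 31)] [cite: PastenShimura2024, Prop. 6.13, Lemma 6.18] [cite: SilvermanAEC2009, VII.5 Prop. 5.1] [cite: Cremona2006, Table 1 (Cremona label 472410bu1)] -/
theorem u0_at_472410bu1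
    (hGZK : rank_eq_analyticRank_of_analyticRank_le_one) (hmod : hasEntireLFunction_rat)
    (hnf : exists_isNewformOf) (hJL : nonempty_shimuraParametrizationData)
    (hCO : PastenShimura2024_componentOrders)
    (hHK : shimuraCurve_heegnerPoint_grossZagier_kolyvagin)
    {W : WeierstrassCurve ℚ} [W.IsElliptic] [W.IsGloballyMinimal] (hWeq : W = (⟨1, -1, 1, -137552897, -620682608879⟩ : WeierstrassCurve ℚ))
    (hN : W.conductorNorm ℤ = 472410) [NeZero (W.conductorNorm ℤ)] (hr : W.analyticRank = 0)
    (Dt : ModularParametrizationData W (W.conductorNorm ℤ)) (hc : ¬ (3 : ℤ) ∣ Dt.c)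
    (hLt0 : (W.quadraticTwist (((-23 : ℤ) : ℚ))).entireLFunction 1 = 0)
    (hLt1 : deriv (W.quadraticTwist (((-23 : ℤ) : ℚ))).entireLFunction 1 ≠ 0)
    {qd : ℚ} (hqd : haveI := isElliptic_sWd472410bu1; shaAn (⟨1, -1, 1, -72765482348, 7552281895121647⟩ : WeierstrassCurve ℚ) = (qd : ℂ))
    (hvd : padicValRat 3 qd ≤ 0) :
    MissingUpperBoundAt W 3 := by
  subst hWeq
  haveI := isElliptic_sWd472410bu1; haveI := isGloballyMinimal_sWd472410bu1
  have hI : integralModelInt (⟨1, -1, 1, -137552897, -620682608879⟩ : WeierstrassCurve ℚ) = (⟨1, -1, 1, -137552897, -620682608879⟩ : WeierstrassCurve ℤ) :=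
    integralModelInt_eq_of_map_eq _ (map_mk_int 1 (-1) 1 (-137552897) (-620682608879))
  have hGS := subGss_three_472410bu1 (W := (⟨1, -1, 1, -137552897, -620682608879⟩ : WeierstrassCurve ℚ)) rfl
  have hs₁ : haveI : Fact (Nat.Prime 181) := ⟨by norm_num⟩; (⟨1, -1, 1, -137552897, -620682608879⟩ : WeierstrassCurve ℚ).HasSplitMultiplicativeReductionAtPrime 181 := by
    refine IntModel.hasSplitMultiplicativeReductionAtPrime_of_intModel_of_root (hp := ⟨by norm_num⟩) hI 181 (by rw [Δ_eq_472410bu1]; norm_num) (by rw [c₄_eq_472410bu1]; norm_num) ⟨4, ?_⟩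
    simp only [WeierstrassCurve.c₄, WeierstrassCurve.b₂, WeierstrassCurve.b₄, WeierstrassCurve.b₆]; push_cast; decide
  have hs₂ : haveI : Fact (Nat.Prime 5) := ⟨by norm_num⟩; (⟨1, -1, 1, -137552897, -620682608879⟩ : WeierstrassCurve ℚ).HasSplitMultiplicativeReductionAtPrime 5 := by
    refine IntModel.hasSplitMultiplicativeReductionAtPrime_of_intModel_of_root (hp := ⟨by norm_num⟩) hI 5 (by rw [Δ_eq_472410bu1]; norm_num) (by rw [c₄_eq_472410bu1]; norm_num) ⟨1, ?_⟩
    simp only [WeierstrassCurve.c₄, WeierstrassCurve.b₂, WeierstrassCurve.b₄, WeierstrassCurve.b₆]; push_cast; decide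
  haveI : Fact ((-23 : ℤ) < 0) := ⟨by norm_num⟩; haveI : Fact (Nat.Prime 181) := ⟨by norm_num⟩; haveI : Fact (Nat.Prime 5) := ⟨by norm_num⟩
  have hothers : ∀ (ℓ : ℕ) [Fact ℓ.Prime], ℓ ≠ 181 → ℓ ≠ 5 → (⟨1, -1, 1, -137552897, -620682608879⟩ : WeierstrassCurve ℚ).HasSplitMultiplicativeReductionAtPrime ℓ →
      ¬ 3 ∣ padicValInt ℓ (⟨1, -1, 1, -137552897, -620682608879⟩ : WeierstrassCurve ℚ).minimalDiscriminantInt := by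
    intro ℓ hℓF hne₁ hne₂ hs
    have hd := dvd_minimalDiscriminantInt_of_mult _ ℓ hs.hasMultiplicativeReductionAtPrime
    rw [IntModel.minimalDiscriminantInt_eq hI, Δ_eq_472410bu1] at hd
    have hmem := mem_of_prime_dvd_of_prodPow_eq _ krausList_472410bu1 hℓF.out hd
    simp only [List.map_cons, List.map_nil, List.mem_cons, List.not_mem_nil, or_false] at hmem
    rcases hmem with rfl | rfl | rfl | rfl | rfl
    · rw [IntModel.minimalDiscriminantInt_eq hI, Δ_eq_472410bu1, IntModel.padicValInt_eq_of_dvd_of_not_dvd 2 (e := 28) (by norm_num) (by norm_num)]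
      decide
    · exact absurd hs.hasMultiplicativeReductionAtPrime (X9.PrintCert.not_hasMultiplicativeReductionAtPrime_of_dvd_of_dvd hI 3 (by rw [Δ_eq_472410bu1]; norm_num) (by rw [c₄_eq_472410bu1]; norm_num))
    · exact absurd rfl hne₂
    · rw [IntModel.minimalDiscriminantInt_eq hI, Δ_eq_472410bu1, IntModel.padicValInt_eq_of_dvd_of_not_dvd 29 (e := 2) (by norm_num) (by norm_num)]
      decide
    · exact absurd rfl hne₁
  have hshape : ∀ (q : ℕ) [Fact q.Prime], 3 ∣ ((⟨1, -1, 1, -137552897, -620682608879⟩ : WeierstrassCurve ℚ).baseChange ℚ_[q]).localTamagawaNumber ℤ_[q] →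
      (⟨1, -1, 1, -137552897, -620682608879⟩ : WeierstrassCurve ℚ).HasSplitMultiplicativeReductionAtPrime q := by
    intro q hqF h3
    by_cases hd : (q : ℤ) ∣ minimalDiscriminantInt (⟨1, -1, 1, -137552897, -620682608879⟩ : WeierstrassCurve ℚ)
    swap
    · exact absurd h3 (not_three_dvd_localTamagawaNumber_of_not_dvd _ q hd)
    rw [IntModel.minimalDiscriminantInt_eq hI, Δ_eq_472410bu1] at hd
    have hmem := mem_of_prime_dvd_of_prodPow_eq _ krausList_472410bu1 hqF.out hd
    simp only [List.map_cons, List.map_nil, List.mem_cons, List.not_mem_nil, or_false] at hmem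
    rcases hmem with rfl | rfl | rfl | rfl | rfl
    · exact (Koly.split_and_three_dvd_of_mult_of_three_dvd_localTamagawaNumber _ 2 (IntModel.hasMultiplicativeReductionAtPrime_of_intModel hI 2 (by rw [Δ_eq_472410bu1]; norm_num) (by rw [c₄_eq_472410bu1]; norm_num)) h3).1
    · have hc3 : ((⟨1, -1, 1, -137552897, -620682608879⟩ : WeierstrassCurve ℚ).baseChange ℚ_[3]).localTamagawaNumber ℤ_[3] = 2 := -- additive `3` (I0*): Tate certificate
        (IntModelTam.localTamagawaNumber_padic_eq_of_intModel_of_tamZ hI 3 (F := ⟨3, 9, 1, 1, 8, 6, 0, 1⟩) rfl (by decide +kernel)).trans (by decide)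
      rw [hc3] at h3; exact absurd h3 (by decide)
    · exact hs₂
    · exact (Koly.split_and_three_dvd_of_mult_of_three_dvd_localTamagawaNumber _ 29 (IntModel.hasMultiplicativeReductionAtPrime_of_intModel hI 29 (by rw [Δ_eq_472410bu1]; norm_num) (by rw [c₄_eq_472410bu1]; norm_num)) h3).1
    · exact hs₁
  have hjac : ∀ ℓ : ℕ, ℓ.Prime → ℓ ∣ (⟨1, -1, 1, -137552897, -620682608879⟩ : WeierstrassCurve ℚ).conductorNorm ℤ → ℓ ≠ 181 → ℓ ≠ 5 → ℓ ≠ 2 →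
      jacobiSym (-23) ℓ = 1 := by
    intro ℓ hℓ hℓN hne₁ hne₂ hℓ2
    rw [hN] at hℓN
    have hmem : ℓ ∈ Nat.primeFactors 472410 := Nat.mem_primeFactors.mpr ⟨hℓ, hℓN, by norm_num⟩
    rw [show Nat.primeFactors 472410 = {2, 3, 5, 29, 181} by decide +kernel] at hmem
    simp only [Finset.mem_insert, Finset.mem_singleton] at hmem
    rcases hmem with rfl | rfl | rfl | rfl | rfl
    · exact absurd rfl hℓ2
    · norm_num [jacobiSym.mod_left]
    · exact absurd rfl hne₂
    · norm_num [jacobiSym.mod_left]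
    · exact absurd rfl hne₁
  have hWd : (⟨1, (-6 : ℚ), ((1:ℚ)/2), ((1:ℚ)/2)⟩ : VariableChange ℚ) • (⟨1, -1, 1, -137552897, -620682608879⟩ : WeierstrassCurve ℚ).quadraticTwist (((-23 : ℤ) : ℚ)) =
      (⟨1, -1, 1, -72765482348, 7552281895121647⟩ : WeierstrassCurve ℚ) := by
    push_cast; ext <;> simp [WeierstrassCurve.variableChange_a₁, WeierstrassCurve.variableChange_a₂,
      WeierstrassCurve.variableChange_a₃, WeierstrassCurve.variableChange_a₄, WeierstrassCurve.variableChange_a₆,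
      WeierstrassCurve.quadraticTwist, WeierstrassCurve.b₂, WeierstrassCurve.b₄, WeierstrassCurve.b₆] <;> norm_num
  exact leafRankZeroUpper_three_of_twoCarriers_of_sqrtField hGZK hmod hnf hJL hCO hHK _ hGS.1 hGS.2 hr rfl Dt hc
    (q₁ := 181) (q₂ := 5) (by decide) hs₁ hs₂ hothers hshape (by decide) (by decide)
    (-23) (by norm_num)
    (by rw [show (-23 : ℤ).natAbs = 23 by rfl, Nat.squarefree_iff_nodup_primeFactorsList (by norm_num)]; simp)
    (Or.inr ⟨by decide, by norm_num [jacobiSym.mod_left]⟩) (by norm_num) (by norm_num [jacobiSym.mod_left]) (by norm_num) hjac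
    (fun _ _ ↦ by norm_num) hLt0 hLt1 _ _ hWd hqd hvd

/-! ## §34 `113274bp1` = `[1, -1, 1, -641, -6407]`, `N = 113274 = 2·3^2·7·29·31` (`2`: I3, `c = 3`, split, `3`: I₀*, `c = 2`, `7`: I3, `c = 3`, split, `29`: I1, `c = 1`, non-split, `31`: I1, `c = 1`, non-split); carriers `S = {2, 7}` (split, `3 ∣ ord Δ`), (DEG) by two multiplicative primes outside `S`: `ℓ₀ = 29` (`3 ∤ ord`), `t = 31` (Pasten–Shimura L6.16);
`r_an = 0`, `#E(ℚ)_tors = 1`, `∏ c_ℓ = 18`, `#Ш(E)_an = 1` (Cremona/LMFDB, displayed where used); class `113274bp` of size 1.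
`V = E^{(-3)}_min = [1, -1, 0, -71, 261]` (`#Ṽ(𝔽₃) = 4`).  JSW field `K = ℚ(√-179)` (`179` prime; `2`, `7` inert, every other `ℓ ∣ N` split): the least such `D` (among those tried) with a CERTIFIED twist unit
(kit j318499: root no. `−1`, `L′(Wd,1) = 10.811782`, `Wd = E^{(-179)}_min = [1, -1, 0, -20528268, 37668565592]`, `N(Wd) = 3629412234`, `∏c = 4`, `T = 1`, point by `ellrank(effort=0)`, eclib-full saturation (index 1), `ĥ = 24.683337`,
`X = L′T²/(Ω∏c ĥ) = 1` to `0e+00` — the numerical `#Ш(Wd)_an` given rank `1`). -/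

/-- `V = [1, -1, 0, -71, 261]` (the minimal model of `113274bp1^{(-3)}`, conductor `12586`): `Δ ≠ 0` in the kernel. [cite: Cremona2006, Table 1 (Cremona label 113274bp1)] -/
theorem isElliptic_sV113274bp1 : (⟨1, -1, 0, -71, 261⟩ : WeierstrassCurve ℚ).IsElliptic :=
  isElliptic_of_discOf_ne_zero 1 (-1) 0 (-71) 261 (by decide +kernel)

/-- `V` is globally minimal: `|Δ| = 2^3·7^3·29·31` kernel-checked, Kraus' criterion prime by prime. [cite: Kraus1989, Prop. 1 and Prop. 2]
[cite: SilvermanAEC2009, VII.1 Remark 1.1] [cite: Cremona2006, Table 1 (Cremona label 113274bp1)] -/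
theorem isGloballyMinimal_sV113274bp1 : (⟨1, -1, 0, -71, 261⟩ : WeierstrassCurve ℚ).IsGloballyMinimal :=
  isGloballyMinimal_of_krausCriterion₃_factored 1 (-1) 0 (-71) 261
    [(2, 3), (7, 3), (29, 1), (31, 1)] (by decide +kernel)
    (by intro qe hqe; simp only [List.mem_cons, List.not_mem_nil, or_false] at hqe
        rcases hqe with rfl | rfl | rfl | rfl <;> norm_num)
    (by set_option synthInstance.maxSize 2000 in decide +kernel)

/-- `Wd = [1, -1, 0, -20528268, 37668565592]` (the minimal model of the twist `113274bp1^{(-179)}`, conductor `3629412234`): `Δ ≠ 0` in the kernel. [cite: Cremona2006, Table 1 (Cremona label 113274bp1)] -/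
theorem isElliptic_sWd113274bp1 : (⟨1, -1, 0, -20528268, 37668565592⟩ : WeierstrassCurve ℚ).IsElliptic :=
  isElliptic_of_discOf_ne_zero 1 (-1) 0 (-20528268) 37668565592 (by decide +kernel)

/-- `Wd` is globally minimal: `|Δ| = 2^3·3^6·7^3·29·31·179^6` kernel-checked, Kraus' criterion prime by prime. [cite: Kraus1989, Prop. 1 and Prop. 2]
[cite: SilvermanAEC2009, VII.1 Remark 1.1] [cite: Cremona2006, Table 1 (Cremona label 113274bp1)] -/
theorem isGloballyMinimal_sWd113274bp1 : (⟨1, -1, 0, -20528268, 37668565592⟩ : WeierstrassCurve ℚ).IsGloballyMinimal :=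
  isGloballyMinimal_of_krausCriterion₃_factored 1 (-1) 0 (-20528268) 37668565592
    [(2, 3), (3, 6), (7, 3), (29, 1), (31, 1), (179, 6)] (by decide +kernel)
    (by intro qe hqe; simp only [List.mem_cons, List.not_mem_nil, or_false] at hqe
        rcases hqe with rfl | rfl | rfl | rfl | rfl | rfl <;> norm_num)
    (by set_option synthInstance.maxSize 2000 in decide +kernel)

/-- **`113274bp1` is ADDITIVE at `3` and on the cell (G) ∧ ss, IN THE KERNEL**: `3 ∣ Δ`, `3 ∣ c₄`; `C • V^{(-3)} = E` (`[u, r, s, t] = [1, -1, 1/2, 1/2]`) with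
`V` globally minimal, `3 ∤ Δ(V)`, `#Ṽ(𝔽₃) = 4` (`a₃(V) = 0`, supersingular), whence `TypeG`, `SubGord`, `SubGss` at `3` (g13's block, unchanged).
[cite: SilvermanAEC2009, VII.5 Prop. 5.1 (a), (c)] [cite: Delbourgo1998, §1.5 (G)] [cite: Cremona2006, Table 1 (Cremona label 113274bp1)] -/
theorem subGss_three_113274bp1 {W : WeierstrassCurve ℚ} [W.IsElliptic] [W.IsGloballyMinimal] (hWeq : W = (⟨1, -1, 1, -641, -6407⟩ : WeierstrassCurve ℚ)) :
    Addv W 3 ∧ SubGss W 3 := by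
  subst hWeq
  haveI := isElliptic_sV113274bp1
  haveI := isGloballyMinimal_sV113274bp1
  have hIW : integralModelInt (⟨1, -1, 1, -641, -6407⟩ : WeierstrassCurve ℚ) = (⟨1, -1, 1, -641, -6407⟩ : WeierstrassCurve ℤ) :=
    integralModelInt_eq_of_map_eq _ (map_mk_int 1 (-1) 1 (-641) (-6407))
  have hadd : Addv (⟨1, -1, 1, -641, -6407⟩ : WeierstrassCurve ℚ) 3 := Additive.addv_of_intModel hIW 3 (by decide +kernel) (by decide +kernel)
  have hIV : integralModelInt (⟨1, -1, 0, -71, 261⟩ : WeierstrassCurve ℚ) = (⟨1, -1, 0, -71, 261⟩ : WeierstrassCurve ℤ) :=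
    integralModelInt_eq_of_map_eq _ (map_mk_int 1 (-1) 0 (-71) 261)
  have hcV : Nat.card ((((⟨1, -1, 0, -71, 261⟩ : WeierstrassCurve ℤ)).map (Int.castRingHom (ZMod 3))).toAffine.Point) = 4 := by
    have h := natCard_point_eq_countPoints 1 (-1) 0 (-71) 261 3 (by norm_num) (by decide +kernel)
    have h' : countPoints [1, -1, 0, -71, 261] 3 = 4 := countPoints_eq_of_fast (by decide +kernel)
    exact_mod_cast h.trans h'
  have hgood : GoodSS (⟨1, -1, 0, -71, 261⟩ : WeierstrassCurve ℚ) 3 := Supersingular.goodSS_of_intModel 3 hIV (by decide +kernel) hcV (by decide)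
  have hVW : (⟨1, (-1 : ℚ), ((1:ℚ)/2), ((1:ℚ)/2)⟩ : VariableChange ℚ) • (⟨1, -1, 0, -71, 261⟩ : WeierstrassCurve ℚ).quadraticTwist (-3) =
      (⟨1, -1, 1, -641, -6407⟩ : WeierstrassCurve ℚ) := by
    ext <;> simp [WeierstrassCurve.variableChange_a₁, WeierstrassCurve.variableChange_a₂,
      WeierstrassCurve.variableChange_a₃, WeierstrassCurve.variableChange_a₄, WeierstrassCurve.variableChange_a₆,
      WeierstrassCurve.quadraticTwist, WeierstrassCurve.b₂, WeierstrassCurve.b₄, WeierstrassCurve.b₆] <;> norm_num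
  obtain ⟨C, hC⟩ := exists_variableChange_quadraticTwist_symm (⟨1, -1, 1, -641, -6407⟩ : WeierstrassCurve ℚ)
    (⟨1, -1, 0, -71, 261⟩ : WeierstrassCurve ℚ) (d := (-3 : ℚ)) (by norm_num) ⟨_, hVW⟩
  have hC' : C • (⟨1, -1, 1, -641, -6407⟩ : WeierstrassCurve ℚ).quadraticTwist ((-1 : ℚ) ^ ((3 : ℕ) / 2) * (3 : ℕ)) =
      (⟨1, -1, 0, -71, 261⟩ : WeierstrassCurve ℚ) := by
    rw [O5.pstar_three]; exact hC
  have hG : TypeG (⟨1, -1, 1, -641, -6407⟩ : WeierstrassCurve ℚ) 3 := (typeG_three_iff_good_twist _ hadd _ C hC').mpr hgood.1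
  exact ⟨hadd, (O5.subGss_three_iff_subGord_and_goodSS_twist _ hadd _ C hC).mpr
    ⟨subGord_three_of_typeG_of_addv _ hG hadd, hgood⟩⟩

/-- `Δ(E₀) = -1798338024 = -2^3·3^6·7^3·29·31` on the integer equation of `113274bp1`. [cite: Cremona2006, Table 1 (Cremona label 113274bp1)] -/
theorem Δ_eq_113274bp1 : (⟨1, -1, 1, -641, -6407⟩ : WeierstrassCurve ℤ).Δ = -1798338024 := by
  norm_num [WeierstrassCurve.Δ, WeierstrassCurve.b₂, WeierstrassCurve.b₄, WeierstrassCurve.b₆, WeierstrassCurve.b₈]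

/-- `c₄(E₀) = 30753` on the integer equation of `113274bp1`. [cite: Cremona2006, Table 1 (Cremona label 113274bp1)] -/
theorem c₄_eq_113274bp1 : (⟨1, -1, 1, -641, -6407⟩ : WeierstrassCurve ℤ).c₄ = 30753 := by
  norm_num [WeierstrassCurve.c₄, WeierstrassCurve.b₂, WeierstrassCurve.b₄]

/-- The Kraus list of `113274bp1` consists of primes and multiplies to `|Δ(E₀)|`, IN THE KERNEL: a prime dividing `Δ_min` is one of `[2, 3, 7, 29, 31]`. [cite: Cremona2006, Table 1 (Cremona label 113274bp1)] -/
theorem krausList_113274bp1 : (∀ qe ∈ ([(2, 3), (3, 6), (7, 3), (29, 1), (31, 1)] : List (ℕ × ℕ)), qe.1.Prime) ∧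
    (([(2, 3), (3, 6), (7, 3), (29, 1), (31, 1)] : List (ℕ × ℕ)).map fun qe => qe.1 ^ qe.2).prod = (-1798338024 : ℤ).natAbs :=
  ⟨by decide +kernel, by decide +kernel⟩

/-- **U₀ AT `113274bp1` BY THE INERT-CARRIER (Shimura-curve) ROAD, TU₀|inert** — `MissingUpperBoundAt W 3` at `W = E` (`r_an = 0`) from rhp-p2 g10's certificate shape
p662479 `leafRankZeroUpper_three_of_shimuraInertDatum_of_twistUnitZero` (Pasten–Shimura two-outside (DEG)) through the §0 door `leafRankOneUpper_three_of_twoInert_twoOutside_of_sqrtField` of part one.  PRINTED: `hGZK hmod hnf hJL hCO hHK`.  KERNEL: `Addv ∧ SubGss` at `3`;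
`2`, `7` split (nodal roots `0`, `2`); every prime of `Δ_min` enumerated (`krausList_113274bp1`) for `hothers` and `hshape` (`c = 1` off `Δ_min`, Kodaira–Néron at the
multiplicative primes, Tate certificates at the additive primes `[3]`); the congruences making `2`, `7` inert and the other `ℓ ∣ N` split in `ℚ(√-179)`; the twist
identity `Cd • E^{(-179)} = Wd`, `Cd = [1, -45, 1/2, 0]`, with `Wd` Kraus-minimal.  DISPLAYED: `hN`, `hr` (`r_an = 0`), `Dt`/`hc` (`3 ∤ c(Dt)`), `hLt0`/`hLt1` (`L(E^{(-179)},1) = 0 ≠ L′(E^{(-179)},1)`; census: root number `−1`, `L′(Wd,1) ≈ 10.811782`),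
`hqd`/`hvd` (`#Ш(Wd)_an = 1`; census: `X = L′·T²/(Ω·∏c·ĥ(P)) = 1` to `0.0e+00` at the eclib-full-saturated point `P` of height `24.683337` found by `ellrank(effort=0)`).
NO ¬CM / S2 / Σ / L₀ / L₁.  Per curve; U₀ (26024) stays OPEN class-wide; BSD is NOT proved by this.
[cite: JetchevSkinnerWan2017, §7.4.2 (p. 31)] [cite: PastenShimura2024, Prop. 6.13, Lemma 6.18] [cite: SilvermanAEC2009, VII.5 Prop. 5.1] [cite: Cremona2006, Table 1 (Cremona label 113274bp1)] -/
theorem u0_at_113274bp1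
    (hGZK : rank_eq_analyticRank_of_analyticRank_le_one) (hmod : hasEntireLFunction_rat)
    (hnf : exists_isNewformOf) (hJL : nonempty_shimuraParametrizationData)
    (hCO : PastenShimura2024_componentOrders)
    (hHK : shimuraCurve_heegnerPoint_grossZagier_kolyvagin)
    {W : WeierstrassCurve ℚ} [W.IsElliptic] [W.IsGloballyMinimal] (hWeq : W = (⟨1, -1, 1, -641, -6407⟩ : WeierstrassCurve ℚ))
    (hN : W.conductorNorm ℤ = 113274) [NeZero (W.conductorNorm ℤ)] (hr : W.analyticRank = 0)
    (Dt : ModularParametrizationData W (W.conductorNorm ℤ)) (hc : ¬ (3 : ℤ) ∣ Dt.c)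
    (hLt0 : (W.quadraticTwist (((-179 : ℤ) : ℚ))).entireLFunction 1 = 0)
    (hLt1 : deriv (W.quadraticTwist (((-179 : ℤ) : ℚ))).entireLFunction 1 ≠ 0)
    {qd : ℚ} (hqd : haveI := isElliptic_sWd113274bp1; shaAn (⟨1, -1, 0, -20528268, 37668565592⟩ : WeierstrassCurve ℚ) = (qd : ℂ))
    (hvd : padicValRat 3 qd ≤ 0) :
    MissingUpperBoundAt W 3 := by
  subst hWeq
  haveI := isElliptic_sWd113274bp1; haveI := isGloballyMinimal_sWd113274bp1
  have hI : integralModelInt (⟨1, -1, 1, -641, -6407⟩ : WeierstrassCurve ℚ) = (⟨1, -1, 1, -641, -6407⟩ : WeierstrassCurve ℤ) :=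
    integralModelInt_eq_of_map_eq _ (map_mk_int 1 (-1) 1 (-641) (-6407))
  have hGS := subGss_three_113274bp1 (W := (⟨1, -1, 1, -641, -6407⟩ : WeierstrassCurve ℚ)) rfl
  have hs₁ : haveI : Fact (Nat.Prime 2) := ⟨by norm_num⟩; (⟨1, -1, 1, -641, -6407⟩ : WeierstrassCurve ℚ).HasSplitMultiplicativeReductionAtPrime 2 := by
    refine IntModel.hasSplitMultiplicativeReductionAtPrime_of_intModel_of_root (hp := ⟨by norm_num⟩) hI 2 (by rw [Δ_eq_113274bp1]; norm_num) (by rw [c₄_eq_113274bp1]; norm_num) ⟨0, ?_⟩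
    simp only [WeierstrassCurve.c₄, WeierstrassCurve.b₂, WeierstrassCurve.b₄, WeierstrassCurve.b₆]; push_cast; decide
  have hs₂ : haveI : Fact (Nat.Prime 7) := ⟨by norm_num⟩; (⟨1, -1, 1, -641, -6407⟩ : WeierstrassCurve ℚ).HasSplitMultiplicativeReductionAtPrime 7 := by
    refine IntModel.hasSplitMultiplicativeReductionAtPrime_of_intModel_of_root (hp := ⟨by norm_num⟩) hI 7 (by rw [Δ_eq_113274bp1]; norm_num) (by rw [c₄_eq_113274bp1]; norm_num) ⟨2, ?_⟩
    simp only [WeierstrassCurve.c₄, WeierstrassCurve.b₂, WeierstrassCurve.b₄, WeierstrassCurve.b₆]; push_cast; decide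
  haveI : Fact ((-179 : ℤ) < 0) := ⟨by norm_num⟩; haveI : Fact (Nat.Prime 2) := ⟨by norm_num⟩; haveI : Fact (Nat.Prime 7) := ⟨by norm_num⟩
  have hothers : ∀ (ℓ : ℕ) [Fact ℓ.Prime], ℓ ≠ 2 → ℓ ≠ 7 → (⟨1, -1, 1, -641, -6407⟩ : WeierstrassCurve ℚ).HasSplitMultiplicativeReductionAtPrime ℓ →
      ¬ 3 ∣ padicValInt ℓ (⟨1, -1, 1, -641, -6407⟩ : WeierstrassCurve ℚ).minimalDiscriminantInt := by
    intro ℓ hℓF hne₁ hne₂ hs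
    have hd := dvd_minimalDiscriminantInt_of_mult _ ℓ hs.hasMultiplicativeReductionAtPrime
    rw [IntModel.minimalDiscriminantInt_eq hI, Δ_eq_113274bp1] at hd
    have hmem := mem_of_prime_dvd_of_prodPow_eq _ krausList_113274bp1 hℓF.out hd
    simp only [List.map_cons, List.map_nil, List.mem_cons, List.not_mem_nil, or_false] at hmem
    rcases hmem with rfl | rfl | rfl | rfl | rfl
    · exact absurd rfl hne₁
    · exact absurd hs.hasMultiplicativeReductionAtPrime (X9.PrintCert.not_hasMultiplicativeReductionAtPrime_of_dvd_of_dvd hI 3 (by rw [Δ_eq_113274bp1]; norm_num) (by rw [c₄_eq_113274bp1]; norm_num))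
    · exact absurd rfl hne₂
    · rw [IntModel.minimalDiscriminantInt_eq hI, Δ_eq_113274bp1, IntModel.padicValInt_eq_of_dvd_of_not_dvd 29 (e := 1) (by norm_num) (by norm_num)]
      decide
    · rw [IntModel.minimalDiscriminantInt_eq hI, Δ_eq_113274bp1, IntModel.padicValInt_eq_of_dvd_of_not_dvd 31 (e := 1) (by norm_num) (by norm_num)]
      decide
  have hshape : ∀ (q : ℕ) [Fact q.Prime], 3 ∣ ((⟨1, -1, 1, -641, -6407⟩ : WeierstrassCurve ℚ).baseChange ℚ_[q]).localTamagawaNumber ℤ_[q] →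
      (⟨1, -1, 1, -641, -6407⟩ : WeierstrassCurve ℚ).HasSplitMultiplicativeReductionAtPrime q := by
    intro q hqF h3
    by_cases hd : (q : ℤ) ∣ minimalDiscriminantInt (⟨1, -1, 1, -641, -6407⟩ : WeierstrassCurve ℚ)
    swap
    · exact absurd h3 (not_three_dvd_localTamagawaNumber_of_not_dvd _ q hd)
    rw [IntModel.minimalDiscriminantInt_eq hI, Δ_eq_113274bp1] at hd
    have hmem := mem_of_prime_dvd_of_prodPow_eq _ krausList_113274bp1 hqF.out hd
    simp only [List.map_cons, List.map_nil, List.mem_cons, List.not_mem_nil, or_false] at hmem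
    rcases hmem with rfl | rfl | rfl | rfl | rfl
    · exact hs₁
    · have hc3 : ((⟨1, -1, 1, -641, -6407⟩ : WeierstrassCurve ℚ).baseChange ℚ_[3]).localTamagawaNumber ℤ_[3] = 2 := -- additive `3` (I0*): Tate certificate
        (IntModelTam.localTamagawaNumber_padic_eq_of_intModel_of_tamZ hI 3 (F := ⟨3, 9, 1, 1, 8, 6, 0, 1⟩) rfl (by decide +kernel)).trans (by decide)
      rw [hc3] at h3; exact absurd h3 (by decide)
    · exact hs₂
    · exact (Koly.split_and_three_dvd_of_mult_of_three_dvd_localTamagawaNumber _ 29 (IntModel.hasMultiplicativeReductionAtPrime_of_intModel hI 29 (by rw [Δ_eq_113274bp1]; norm_num) (by rw [c₄_eq_113274bp1]; norm_num)) h3).1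
    · exact (Koly.split_and_three_dvd_of_mult_of_three_dvd_localTamagawaNumber _ 31 (IntModel.hasMultiplicativeReductionAtPrime_of_intModel hI 31 (by rw [Δ_eq_113274bp1]; norm_num) (by rw [c₄_eq_113274bp1]; norm_num)) h3).1
  have hjac : ∀ ℓ : ℕ, ℓ.Prime → ℓ ∣ (⟨1, -1, 1, -641, -6407⟩ : WeierstrassCurve ℚ).conductorNorm ℤ → ℓ ≠ 2 → ℓ ≠ 7 → ℓ ≠ 2 →
      jacobiSym (-179) ℓ = 1 := by
    intro ℓ hℓ hℓN hne₁ hne₂ hℓ2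
    rw [hN] at hℓN
    have hmem : ℓ ∈ Nat.primeFactors 113274 := Nat.mem_primeFactors.mpr ⟨hℓ, hℓN, by norm_num⟩
    rw [show Nat.primeFactors 113274 = {2, 3, 7, 29, 31} by decide +kernel] at hmem
    simp only [Finset.mem_insert, Finset.mem_singleton] at hmem
    rcases hmem with rfl | rfl | rfl | rfl | rfl
    · exact absurd rfl hne₁
    · norm_num [jacobiSym.mod_left]
    · exact absurd rfl hne₂
    · norm_num [jacobiSym.mod_left]
    · norm_num [jacobiSym.mod_left]
  have hWd : (⟨1, (-45 : ℚ), ((1:ℚ)/2), (0 : ℚ)⟩ : VariableChange ℚ) • (⟨1, -1, 1, -641, -6407⟩ : WeierstrassCurve ℚ).quadraticTwist (((-179 : ℤ) : ℚ)) =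
      (⟨1, -1, 0, -20528268, 37668565592⟩ : WeierstrassCurve ℚ) := by
    push_cast; ext <;> simp [WeierstrassCurve.variableChange_a₁, WeierstrassCurve.variableChange_a₂,
      WeierstrassCurve.variableChange_a₃, WeierstrassCurve.variableChange_a₄, WeierstrassCurve.variableChange_a₆,
      WeierstrassCurve.quadraticTwist, WeierstrassCurve.b₂, WeierstrassCurve.b₄, WeierstrassCurve.b₆] <;> norm_num
  haveI : Fact (Nat.Prime 29) := ⟨by norm_num⟩
  haveI : Fact (Nat.Prime 31) := ⟨by norm_num⟩
  have hm₀ : (⟨1, -1, 1, -641, -6407⟩ : WeierstrassCurve ℚ).HasMultiplicativeReductionAtPrime 29 :=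
    IntModel.hasMultiplicativeReductionAtPrime_of_intModel hI 29 (by rw [Δ_eq_113274bp1]; norm_num) (by rw [c₄_eq_113274bp1]; norm_num)
  have hmt : (⟨1, -1, 1, -641, -6407⟩ : WeierstrassCurve ℚ).HasMultiplicativeReductionAtPrime 31 :=
    IntModel.hasMultiplicativeReductionAtPrime_of_intModel hI 31 (by rw [Δ_eq_113274bp1]; norm_num) (by rw [c₄_eq_113274bp1]; norm_num)
  have hv₀ : ¬ 3 ∣ padicValInt 29 (⟨1, -1, 1, -641, -6407⟩ : WeierstrassCurve ℚ).minimalDiscriminantInt := by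
    rw [IntModel.minimalDiscriminantInt_eq hI, Δ_eq_113274bp1, IntModel.padicValInt_eq_of_dvd_of_not_dvd 29 (e := 1) (by norm_num) (by norm_num)]
    decide
  exact leafRankZeroUpper_three_of_twoInert_twoOutside_of_sqrtField hGZK hmod hnf hJL hCO hHK _ hGS.1 hGS.2 hr rfl Dt hc
    (q₁ := 2) (q₂ := 7) (by decide) hs₁ hs₂ hothers hshape 29 31 hm₀ hmt (by decide) (by decide) (by decide) (by decide) (by decide) hv₀
    (-179) (by norm_num)
    (by rw [show (-179 : ℤ).natAbs = 179 by rfl, Nat.squarefree_iff_nodup_primeFactorsList (by norm_num)]; simp)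
    (Or.inl ⟨rfl, by norm_num⟩) (by norm_num) (by norm_num [jacobiSym.mod_left]) (by norm_num) hjac
    (fun _ h ↦ absurd rfl h) hLt0 hLt1 _ _ hWd hqd hvd

end Summit.BirchSwinnertonDyer.BirchSwinnertonDyer.Theorems.RamifiedHeegnerPairTwistUnitInertZero

end
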